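/-
Origin: expansion seat `planner-pub-hodgecm-pv13-g3-0`, handover #11 2026-08-18T08:07:15Z (`HOME/pub-hodgecm-pv13-g3/lean/Pv13g3/SplitLevel.lean`, md5 6da4daee, 127 lines);
landed by the gen-7 packager in gate run 26 as `HodgeCM/PerL34/LocalFactors/SplitLevel.lean` (verbatim).
-/
/-
Copyright: HodgeCM publication cell (pub-hodgecm), DAG node N31h (seam S3) — the LEVEL HALF of the D4
identification at a split place, for pv07-g2's model of the unitary group of the split line.  Prover seat
pv13-g3 (DAG-NODE PROVER #13, generation 3), file #11.  Released under the package licence.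

# `U(W_i)(𝒪_v) ↔ 𝒪_v^×` under `U(W_i)(L_{0,v}) ≅ L_{0,v}^×` at a split place

Text under adjudication (NOT cited), PerL v5 l. 610/617 "If `v` splits in `L/L₀` then `U(W_i)(L_{0,v}) ≅ L_{0,v}^×`"
and l. 628 ("`K_v`-fixed … unramified"): the level `K_v = U(W_i)(𝒪_v)` is matched with the unit group `𝒪_v^×`.
pv07-g2's `LocalFactors/SplitUnitaryLine` (run 25) builds the GROUP half in the kernel:
`unitaryGroup F = {g ∈ (F × F)ˣ : g ḡ = 1}` and `unitaryGroupEquiv F : unitaryGroup F ≃* Fˣ` (first projection).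
This file adds the LEVEL half, which is exactly hypothesis `hτUB` of #10 `SplitShells.thetaLift_ne_zero_of_N31d_ident`
for this model: the integral points `integralPoints F = {g : both coordinates of norm ≤ 1}` (= `U(W_i)(𝒪_v)`,
`𝒪_v = {‖x‖ ≤ 1}`) form a subgroup, and `g ∈ integralPoints F ↔ ‖unitaryGroupEquiv F g‖ = 1`
(`mem_integralPoints_iff_norm_eq_one`); and the TOPOLOGICAL upgrade `unitaryGroupContinuousEquiv F :
unitaryGroup F ≃ₜ* Fˣ` of pv07-g2's `unitaryGroupEquiv` (both directions continuous for the unit topologies) — the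
shape `τ_v : G_v ≃ₜ* L_{0,v}^×` in which #9/#10 take the identification at the split places `v ∈ S`.  Pure algebra +
the multiplicativity of the norm + continuity of units maps; complete proofs; axioms = the standard trio.
-/
import Summits.HodgeConjecture.HodgeCM.PerL34.LocalFactors.SplitUnitaryLine
import Mathlib.Analysis.Normed.Field.Basic
import Mathlib.Topology.Algebra.Group.Basic
import Mathlib.Topology.Algebra.ContinuousMonoidHom

/-! PORT of `HodgeCM/PerL34/LocalFactors/SplitLevel.lean` (HodgeCMPerL run 82) — verbatim mechanical port; provenance in the PORT header line. -/

noncomputable section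

namespace HodgeCM.PerL34.LocalFactors.SplitUnitaryLine

variable {F : Type*} [NormedField F]

/-- for `g ∈ U(W_i)(F)` the inverse unit is the conjugate (flip): its first coordinate is `g`'s second. -/
theorem coe_inv_fst (g : unitaryGroup F) :
    (((g⁻¹ : unitaryGroup F) : (F × F)ˣ) : F × F).1 = (((g : (F × F)ˣ) : F × F)).2 := by
  have h : (((g : (F × F)ˣ)⁻¹ : (F × F)ˣ) : F × F) = conj F ((g : (F × F)ˣ) : F × F) :=
    Units.inv_eq_of_mul_eq_one_right ((mem_unitaryGroup_iff _).1 g.2)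
  rw [Subgroup.coe_inv, h, conj_apply]

/-- … and its second coordinate is `g`'s first. -/
theorem coe_inv_snd (g : unitaryGroup F) :
    (((g⁻¹ : unitaryGroup F) : (F × F)ˣ) : F × F).2 = (((g : (F × F)ˣ) : F × F)).1 := by
  have h : (((g : (F × F)ˣ)⁻¹ : (F × F)ˣ) : F × F) = conj F ((g : (F × F)ˣ) : F × F) :=
    Units.inv_eq_of_mul_eq_one_right ((mem_unitaryGroup_iff _).1 g.2)
  rw [Subgroup.coe_inv, h, conj_apply]

/-- the norms of the two coordinates of `g ∈ U(W_i)(F)` are mutually inverse: `‖g₁‖ * ‖g₂‖ = 1`. -/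
theorem norm_fst_mul_norm_snd (g : unitaryGroup F) :
    ‖(((g : (F × F)ˣ) : F × F)).1‖ * ‖(((g : (F × F)ˣ) : F × F)).2‖ = 1 := by
  rw [← norm_mul, fst_mul_snd_of_mem g.2, norm_one]

variable (F)

/-- **`U(W_i)(𝒪_v)`** in pv07-g2's model: the elements of the unitary group of the split line both of whose
coordinates lie in the valuation ring `𝒪_v = {x : ‖x‖ ≤ 1}` (the stabiliser of the standard lattice `𝒪_v × 𝒪_v`). -/
def integralPoints : Subgroup (unitaryGroup F) where
  carrier := {g | ‖(((g : (F × F)ˣ) : F × F)).1‖ ≤ 1 ∧ ‖(((g : (F × F)ˣ) : F × F)).2‖ ≤ 1}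
  one_mem' := by simp
  mul_mem' := by
    rintro g h ⟨hg₁, hg₂⟩ ⟨hh₁, hh₂⟩
    refine ⟨?_, ?_⟩
    · simp only [Subgroup.coe_mul, Units.val_mul, Prod.fst_mul, norm_mul]
      exact mul_le_one₀ hg₁ (norm_nonneg _) hh₁
    · simp only [Subgroup.coe_mul, Units.val_mul, Prod.snd_mul, norm_mul]
      exact mul_le_one₀ hg₂ (norm_nonneg _) hh₂
  inv_mem' := by
    rintro g ⟨hg₁, hg₂⟩
    exact ⟨by simpa only [Set.mem_setOf_eq, coe_inv_fst] using hg₂,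
      by simpa only [Set.mem_setOf_eq, coe_inv_snd] using hg₁⟩

/-- (Ported verbatim from the HodgeCMPerL package; no docstring in the source.) -/
theorem mem_integralPoints_iff (g : unitaryGroup F) :
    g ∈ integralPoints F ↔ ‖(((g : (F × F)ˣ) : F × F)).1‖ ≤ 1 ∧ ‖(((g : (F × F)ˣ) : F × F)).2‖ ≤ 1 :=
  Iff.rfl

/-- **D4, level half** (PerL v5 l. 610/628; hypothesis `hτUB` of `SplitShells.thetaLift_ne_zero_of_N31d_ident` for
this model): under `U(W_i)(L_{0,v}) ≅ L_{0,v}^×` the integral points `U(W_i)(𝒪_v)` correspond to the units `𝒪_v^×`: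
`g ∈ U(W_i)(𝒪_v) ↔ ‖unitaryGroupEquiv F g‖ = 1`. -/
theorem mem_integralPoints_iff_norm_eq_one (g : unitaryGroup F) :
    g ∈ integralPoints F ↔ ‖((unitaryGroupEquiv F g : Fˣ) : F)‖ = 1 := by
  rw [mem_integralPoints_iff, unitaryGroupEquiv_apply, coe_toUnits]
  have hprod := norm_fst_mul_norm_snd g
  set a := ‖(((g : (F × F)ˣ) : F × F)).1‖ with ha
  set b := ‖(((g : (F × F)ˣ) : F × F)).2‖ with hb
  have ha0 : 0 ≤ a := norm_nonneg _
  have hb0 : 0 ≤ b := norm_nonneg _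
  constructor
  · rintro ⟨h₁, h₂⟩
    refine le_antisymm h₁ ?_
    -- `a ≤ 1`, `b ≤ 1`, `a * b = 1` ⇒ `1 ≤ a`
    nlinarith [mul_le_mul_of_nonneg_left h₂ ha0]
  · intro h₁
    refine ⟨h₁.le, ?_⟩
    rw [h₁, one_mul] at hprod
    exact hprod.le

/-- the same through the inverse isomorphism: `(a, a⁻¹) ∈ U(W_i)(𝒪_v) ↔ ‖a‖ = 1`. -/
theorem ofUnits_mem_integralPoints_iff (a : Fˣ) :
    (unitaryGroupEquiv F).symm a ∈ integralPoints F ↔ ‖(a : F)‖ = 1 := by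
  rw [mem_integralPoints_iff_norm_eq_one, MulEquiv.apply_symm_apply]

/-! ### The identification is a homeomorphism (`τ_v : G_v ≃ₜ* L_{0,v}^×`, the shape used by #9/#10 at `v ∈ S`) -/

/-- (Ported verbatim from the HodgeCMPerL package; no docstring in the source.) -/
theorem continuous_unitaryGroupEquiv : Continuous (unitaryGroupEquiv F) :=
  (continuous_fst.units_map (RingHom.fst F F : (F × F) →* F)).comp continuous_subtype_val

/-- (Ported verbatim from the HodgeCMPerL package; no docstring in the source.) -/
theorem continuous_unitaryGroupEquiv_symm : Continuous (unitaryGroupEquiv F).symm := by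
  have h : Continuous fun a : Fˣ => pairUnit F a := by
    refine Units.continuous_iff.2 ⟨?_, ?_⟩
    · exact Units.continuous_val.prodMk Units.continuous_coe_inv
    · exact Units.continuous_coe_inv.prodMk Units.continuous_val
  exact h.subtype_mk _

/-- **D4 (a), topological form**: `U(W_i)(L_{0,v}) ≃ₜ* L_{0,v}^×` — pv07-g2's `unitaryGroupEquiv` with both
directions continuous (unit topologies). -/
def unitaryGroupContinuousEquiv : unitaryGroup F ≃ₜ* Fˣ :=
  { unitaryGroupEquiv F with
    continuous_toFun := continuous_unitaryGroupEquiv F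
    continuous_invFun := continuous_unitaryGroupEquiv_symm F }

/-- (Ported verbatim from the HodgeCMPerL package; no docstring in the source.) -/
@[simp] theorem unitaryGroupContinuousEquiv_apply (g : unitaryGroup F) :
    unitaryGroupContinuousEquiv F g = unitaryGroupEquiv F g := rfl

/-- (Ported verbatim from the HodgeCMPerL package; no docstring in the source.) -/
theorem mem_integralPoints_iff_norm_continuousEquiv (g : unitaryGroup F) :
    g ∈ integralPoints F ↔ ‖((unitaryGroupContinuousEquiv F g : Fˣ) : F)‖ = 1 :=
  mem_integralPoints_iff_norm_eq_one F g

end HodgeCM.PerL34.LocalFactors.SplitUnitaryLine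

end
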